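import Literature.NumberTheory.EllipticCurves.BSDQuadraticDescentProofs
import Mathlib.NumberTheory.LSeries.Convolution

/-!
# Euler products and twists by Dirichlet characters: bookkeeping lemmas

Route `PlecticLegs`, support item `ArtinBaseChange` (stmt-BirchSwinnertonDyer-18261). Bookkeeping
for Mathlib's formal Euler products `ArithmeticFunction.eulerProduct` (coercion `ℤ → ℂ`, finite
pointwise products, finitely supported families), for the **twist** of an arithmetic function by a
Dirichlet character `χ` mod `m` (`n ↦ χ(n) f(n)`, Mathlib's `pmul` with
`toArithmeticFunction (χ ∘ (↑))`: multiplicative on Dirichlet convolutions, commutes with Euler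
products, rescales a local factor `χ • f(q⁻ˢ) = f(χ(q) q⁻ˢ)`), and for inverses of power series of
constant coefficient `1` (`invOfUnit · 1` versus `map`, `rescale`, finite products and powers).
-/

noncomputable section

-- D-0017: single-problem summit, so `Summit.BirchSwinnertonDyer.BirchSwinnertonDyer.…` repeats a
-- namespace BY DESIGN.
set_option linter.dupNamespace false

open scoped Classical
open Filter ArithmeticFunction

namespace Summit.BirchSwinnertonDyer.BirchSwinnertonDyer.Theorems

/-! ## Euler products: coercion, finite products, finite support -/

section EulerProduct

variable {ι : Type*}

/-- A family converging to `1` coefficientwise stays so after the coercion `ℤ → ℂ`. [folklore] -/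
theorem eventually_intCoe_apply_eq_one {f : ι → ArithmeticFunction ℤ}
    (hf : ∀ n, ∀ᶠ i in cofinite, f i n = (1 : ArithmeticFunction ℤ) n) (n : ℕ) :
    ∀ᶠ i in cofinite, (f i : ArithmeticFunction ℂ) n = (1 : ArithmeticFunction ℂ) n := by
  filter_upwards [hf n] with i hi
  rw [intCoe_apply, hi, ← intCoe_apply, intCoe_one]

/-- Coercion `ℤ → ℂ` of a finite product of arithmetic functions. [folklore] -/
theorem intCoe_finset_prod {α : Type*} (s : Finset α) (f : α → ArithmeticFunction ℤ) :
    ((∏ i ∈ s, f i : ArithmeticFunction ℤ) : ArithmeticFunction ℂ) =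
      ∏ i ∈ s, (f i : ArithmeticFunction ℂ) := by
  induction s using Finset.induction_on with
  | empty => simp
  | insert a s ha ih => rw [Finset.prod_insert ha, Finset.prod_insert ha, intCoe_mul, ih]

/-- **The coercion `ℤ → ℂ` commutes with Euler products** (both are coefficientwise limits of the
finite partial products). [folklore] -/
theorem intCoe_eulerProduct (f : ι → ArithmeticFunction ℤ)
    (hf : ∀ n, ∀ᶠ i in cofinite, f i n = (1 : ArithmeticFunction ℤ) n) :
    ((eulerProduct f : ArithmeticFunction ℤ) : ArithmeticFunction ℂ) =
      eulerProduct fun i ↦ (f i : ArithmeticFunction ℂ) := by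
  ext n
  obtain ⟨s, hs1, hs2⟩ := ((tendsTo_eulerProduct_of_tendsTo f hf n).and
    (tendsTo_eulerProduct_of_tendsTo _ (eventually_intCoe_apply_eq_one hf) n)).exists
  rw [intCoe_apply, ← hs1, ← hs2, ← intCoe_finset_prod, intCoe_apply]

/-- A pointwise finite product of families converging to `1` coefficientwise converges to `1`
coefficientwise. [folklore] -/
theorem eventually_finset_prod_apply_eq_one {R : Type*} [CommSemiring R] {α : Type*}
    (s : Finset α) (f : α → ι → ArithmeticFunction R)
    (hf : ∀ a ∈ s, ∀ n, ∀ᶠ i in cofinite, f a i n = (1 : ArithmeticFunction R) n) (n : ℕ) :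
    ∀ᶠ i in cofinite, (∏ a ∈ s, f a i) n = (1 : ArithmeticFunction R) n := by
  -- all coefficients of index `≤ n` of all `f a i`, `a ∈ s`, are eventually those of `1`
  have h : ∀ᶠ i in cofinite, ∀ a ∈ s, ∀ k ≤ n, f a i k = (1 : ArithmeticFunction R) k := by
    rw [Finset.eventually_all]
    intro a ha
    have h' : ∀ k ∈ Finset.range (n + 1), ∀ᶠ i in cofinite, f a i k = (1 : ArithmeticFunction R) k :=
      fun k _ ↦ hf a ha k
    rw [← Finset.eventually_all] at h'
    filter_upwards [h'] with i hi k hk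
    exact hi k (Finset.mem_range.mpr (Nat.lt_succ_of_le hk))
  filter_upwards [h] with i hi
  exact ArithmeticFunction.finsetProd_apply_eq_one_apply_of_le s (fun a ↦ f a i) hi n le_rfl

/-- **The Euler product of a pointwise finite product** of families converging to `1` is the
product of the Euler products (the tree's `eulerProduct_mul_eq`, iterated). [folklore] -/
theorem eulerProduct_finset_prod {R : Type*} [CommSemiring R] {α : Type*} (s : Finset α)
    (f : α → ι → ArithmeticFunction R)
    (hf : ∀ a ∈ s, ∀ n, ∀ᶠ i in cofinite, f a i n = (1 : ArithmeticFunction R) n) :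
    eulerProduct (fun i ↦ ∏ a ∈ s, f a i) = ∏ a ∈ s, eulerProduct (f a) := by
  induction s using Finset.induction_on with
  | empty =>
    simp only [Finset.prod_empty]
    -- the Euler product of the constant family `1` is `1`
    ext n
    obtain ⟨t, ht⟩ := (tendsTo_eulerProduct_of_tendsTo (fun _ : ι ↦ (1 : ArithmeticFunction R))
      (fun n ↦ Eventually.of_forall fun _ ↦ rfl) n).exists
    rw [← ht, Finset.prod_const_one]
  | insert a s ha ih =>
    have hfa := hf a (Finset.mem_insert_self a s)
    have hfs : ∀ b ∈ s, ∀ n, ∀ᶠ i in cofinite, f b i n = (1 : ArithmeticFunction R) n :=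
      fun b hb ↦ hf b (Finset.mem_insert_of_mem hb)
    simp only [Finset.prod_insert ha]
    rw [ArithmeticFunction.eulerProduct_mul_eq _ _ hfa (eventually_finset_prod_apply_eq_one s f hfs),
      ih hfs]

/-- **A finitely supported Euler product is a finite product**: if `f i = 1` off the finite set
`s` then `eulerProduct f = ∏ i ∈ s, f i`. [folklore] -/
theorem eulerProduct_eq_finset_prod_of_eq_one {R : Type*} [CommSemiring R] (s : Finset ι)
    (f : ι → ArithmeticFunction R) (hf : ∀ i ∉ s, f i = 1) :
    eulerProduct f = ∏ i ∈ s, f i := by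
  have hconv : ∀ n, ∀ᶠ i in cofinite, f i n = (1 : ArithmeticFunction R) n := by
    intro n
    refine Filter.eventually_of_mem s.finite_toSet.compl_mem_cofinite fun i hi ↦ ?_
    rw [hf i (fun h ↦ hi (Finset.mem_coe.mpr h))]
  ext n
  obtain ⟨t, ht⟩ := eventually_atTop.mp (tendsTo_eulerProduct_of_tendsTo f hconv n)
  rw [← ht (t ∪ s) Finset.subset_union_left, ← Finset.prod_subset Finset.subset_union_right
    (fun i _ hi ↦ hf i hi)]

end EulerProduct

/-! ## Twisting arithmetic functions by a Dirichlet character -/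

section Twist

open PowerSeries

variable {m : ℕ} (χ : DirichletCharacter ℂ m)

/-- The twist `n ↦ χ(n) f(n)` as an arithmetic function: Mathlib's pointwise product `pmul` with
`toArithmeticFunction (n ↦ χ n)`; its values. [folklore] -/
theorem twist_apply (f : ArithmeticFunction ℂ) (n : ℕ) :
    (toArithmeticFunction (fun k : ℕ ↦ χ (k : ZMod m))).pmul f n = χ (n : ZMod m) * f n := by
  rw [pmul_apply]
  rcases Nat.eq_zero_or_pos n with rfl | hn
  · simp
  · simp [toArithmeticFunction, hn.ne']

/-- The twist of `1` is `1`. [folklore] -/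
theorem twist_one : (toArithmeticFunction (fun k : ℕ ↦ χ (k : ZMod m))).pmul 1 = 1 := by
  ext n
  rw [twist_apply, one_apply]
  split_ifs with h
  · subst h; simp
  · rw [mul_zero]

/-- **Twisting is multiplicative on Dirichlet convolutions** (`χ` is completely multiplicative):
`χ • (f * g) = (χ • f) * (χ • g)`. [folklore] -/
theorem twist_mul (f g : ArithmeticFunction ℂ) :
    (toArithmeticFunction (fun k : ℕ ↦ χ (k : ZMod m))).pmul (f * g) =
      (toArithmeticFunction (fun k : ℕ ↦ χ (k : ZMod m))).pmul f *
        (toArithmeticFunction (fun k : ℕ ↦ χ (k : ZMod m))).pmul g := by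
  ext n
  rw [twist_apply, mul_apply, mul_apply, Finset.mul_sum]
  refine Finset.sum_congr rfl fun x hx ↦ ?_
  rw [twist_apply, twist_apply]
  have hn : x.1 * x.2 = n := (Nat.mem_divisorsAntidiagonal.mp hx).1
  rw [← hn, Nat.cast_mul, map_mul]
  ring

/-- Twisting a finite product. [folklore] -/
theorem twist_finset_prod {α : Type*} (s : Finset α) (f : α → ArithmeticFunction ℂ) :
    (toArithmeticFunction (fun k : ℕ ↦ χ (k : ZMod m))).pmul (∏ a ∈ s, f a) =
      ∏ a ∈ s, (toArithmeticFunction (fun k : ℕ ↦ χ (k : ZMod m))).pmul (f a) := by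
  induction s using Finset.induction_on with
  | empty => simp [twist_one]
  | insert a s ha ih => rw [Finset.prod_insert ha, Finset.prod_insert ha, twist_mul, ih]

/-- **Twisting commutes with Euler products** (it acts coefficientwise). [folklore] -/
theorem twist_eulerProduct {ι : Type*} (f : ι → ArithmeticFunction ℂ)
    (hf : ∀ n, ∀ᶠ i in cofinite, f i n = (1 : ArithmeticFunction ℂ) n) :
    (toArithmeticFunction (fun k : ℕ ↦ χ (k : ZMod m))).pmul (eulerProduct f) =
      eulerProduct fun i ↦ (toArithmeticFunction (fun k : ℕ ↦ χ (k : ZMod m))).pmul (f i) := by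
  have hf' : ∀ n, ∀ᶠ i in cofinite,
      (toArithmeticFunction (fun k : ℕ ↦ χ (k : ZMod m))).pmul (f i) n = (1 : ArithmeticFunction ℂ) n := by
    intro n
    filter_upwards [hf n] with i hi
    rw [twist_apply, hi, ← twist_apply χ 1 n, twist_one]
  ext n
  obtain ⟨s, hs1, hs2⟩ := ((tendsTo_eulerProduct_of_tendsTo f hf n).and
    (tendsTo_eulerProduct_of_tendsTo _ hf' n)).exists
  rw [twist_apply, ← hs1, ← hs2, ← twist_finset_prod, twist_apply]

/-- **Twisting a local factor rescales it**: for `q > 1`, `χ • f(q⁻ˢ) = (rescale (χ q) f)(q⁻ˢ)`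
(the coefficient of `q^{-ks}` is multiplied by `χ(q^k) = χ(q)^k`). [folklore] -/
theorem twist_ofPowerSeries {q : ℕ} (hq : 1 < q) (φ : PowerSeries ℂ) :
    (toArithmeticFunction (fun k : ℕ ↦ χ (k : ZMod m))).pmul (ofPowerSeries q φ) =
      ofPowerSeries q (rescale (χ (q : ZMod m)) φ) := by
  ext n
  rw [twist_apply]
  by_cases hn : ∃ k, q ^ k = n
  · obtain ⟨k, rfl⟩ := hn
    rw [ofPowerSeries_apply_pow hq, ofPowerSeries_apply_pow hq, coeff_rescale, Nat.cast_pow, map_pow]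
  · rw [ofPowerSeries_apply hq, ofPowerSeries_apply hq, Function.extend_apply' _ _ _ hn,
      Function.extend_apply' _ _ _ hn, Pi.zero_apply, mul_zero]

end Twist

/-! ## Power series: coercion, inverses, rescaling -/

section PowerSeriesLemmas

open PowerSeries

/-- Coercion `ℤ → ℂ` of `ofPowerSeries` (`q > 1`). [folklore] -/
theorem intCoe_ofPowerSeries {q : ℕ} (hq : 1 < q) (φ : PowerSeries ℤ) :
    ((ofPowerSeries q φ : ArithmeticFunction ℤ) : ArithmeticFunction ℂ) =
      ofPowerSeries q (φ.map (Int.castRingHom ℂ)) := by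
  ext n
  rw [intCoe_apply]
  by_cases hn : ∃ k, q ^ k = n
  · obtain ⟨k, rfl⟩ := hn
    rw [ofPowerSeries_apply_pow hq, ofPowerSeries_apply_pow hq, coeff_map, eq_intCast]
  · rw [ofPowerSeries_apply hq, ofPowerSeries_apply hq, Function.extend_apply' _ _ _ hn,
      Function.extend_apply' _ _ _ hn, Pi.zero_apply, Pi.zero_apply, Int.cast_zero]

/-- `map` commutes with `invOfUnit · 1` for power series of constant coefficient `1`. [folklore] -/
theorem map_invOfUnit_one {R S : Type*} [CommRing R] [CommRing S] (f : R →+* S) {φ : PowerSeries R}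
    (hφ : constantCoeff φ = 1) : (invOfUnit φ 1).map f = invOfUnit (φ.map f) 1 := by
  symm
  refine PowerSeries.invOfUnit_one_eq_of_mul_eq_one
    (by rw [← coeff_zero_eq_constantCoeff, coeff_map, coeff_zero_eq_constantCoeff, hφ, map_one]) ?_
  rw [← map_mul, mul_invOfUnit φ 1 (by rw [hφ, Units.val_one]), map_one]

/-- `rescale` commutes with `invOfUnit · 1` for power series of constant coefficient `1`.
[folklore] -/
theorem rescale_invOfUnit_one {R : Type*} [CommRing R] (c : R) {φ : PowerSeries R}
    (hφ : constantCoeff φ = 1) : rescale c (invOfUnit φ 1) = invOfUnit (rescale c φ) 1 := by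
  symm
  refine PowerSeries.invOfUnit_one_eq_of_mul_eq_one ?_ ?_
  · rw [← coeff_zero_eq_constantCoeff, coeff_rescale, pow_zero, one_mul, coeff_zero_eq_constantCoeff,
      hφ]
  · rw [← map_mul, mul_invOfUnit φ 1 (by rw [hφ, Units.val_one]), map_one]

/-- `invOfUnit · 1` of a finite product of power series of constant coefficient `1`. [folklore] -/
theorem invOfUnit_one_finset_prod {R : Type*} [CommRing R] {α : Type*} (s : Finset α)
    (φ : α → PowerSeries R) (hφ : ∀ a ∈ s, constantCoeff (φ a) = 1) :
    invOfUnit (∏ a ∈ s, φ a) 1 = ∏ a ∈ s, invOfUnit (φ a) 1 := by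
  induction s using Finset.induction_on with
  | empty =>
    simp only [Finset.prod_empty]
    exact PowerSeries.invOfUnit_one_eq_of_mul_eq_one (map_one _) (mul_one 1)
  | insert a s ha ih =>
    have ha1 := hφ a (Finset.mem_insert_self a s)
    have hs1 : ∀ b ∈ s, constantCoeff (φ b) = 1 := fun b hb ↦ hφ b (Finset.mem_insert_of_mem hb)
    have hprod : constantCoeff (∏ b ∈ s, φ b) = 1 := by
      rw [map_prod]
      exact Finset.prod_eq_one hs1
    rw [Finset.prod_insert ha, Finset.prod_insert ha,
      PowerSeries.invOfUnit_mul_of_constantCoeff_eq_one ha1 hprod, ih hs1]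

/-- `invOfUnit · 1` of a power of a power series of constant coefficient `1`. [folklore] -/
theorem invOfUnit_one_pow {R : Type*} [CommRing R] (φ : PowerSeries R) (hφ : constantCoeff φ = 1)
    (g : ℕ) : invOfUnit (φ ^ g) 1 = (invOfUnit φ 1) ^ g := by
  have h := invOfUnit_one_finset_prod (Finset.range g) (fun _ ↦ φ) fun _ _ ↦ hφ
  rwa [Finset.prod_const, Finset.card_range, Finset.prod_const, Finset.card_range] at h

end PowerSeriesLemmas

end Summit.BirchSwinnertonDyer.BirchSwinnertonDyer.Theorems

end
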